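import Mathlib.Algebra.Order.Antidiag.FinsuppEquiv
import Literature.Barriers.ValiantsHypothesis.BDGIL24AffineInputsVP
import Literature.Computability.AlgebraicComplexity.QPBoundedClosure
import HarnessLib

/-!
# `metaVP` and `metaVQP` do not depend on the circuit model ([BDGIL24, §2.1 / §2.5]) — PROVED
# (`BergEtAl2024.metaVP_eq_setOf_complexity`, `BergEtAl2024.metaVQP_eq_setOf_complexity`)

[BDGIL24] = M. van den Berg, P. Dutta, F. Gesmundo, C. Ikenmeyer, V. Lysikov, *Algebraic
metacomplexity and representation theory*, arXiv:2411.03444. §2.1 (p.6, PDF p.7, p0007.txt:L17–L23):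
"in the definition of algebraic circuits we allow affine linear forms at the input gates […] In
more restrictive circuit definitions, for instance if the input gates are required to be variables,
the associated circuit complexity `c′` might change under the action of `GL_k`. However, both
definitions give the same class VP." §2.5 (p.9, PDF p.10, p0010.txt:L29–L33) defines the classes
of the paper, `metaVP` / `metaVQP`: sequences `(Δ_n)` of metapolynomials of format
`(δ(n), n, k(n))` with `k(n)` polynomially bounded in `n` and `δ(n)`, `cc(Δ_n)` polynomially
(resp. `cc(Δ_n)` quasipolynomially) bounded in `N(n) = binom(k(n)+n−1, n)`.

This file proves the class-level form of the §2.1 remark for the paper's own classes: in the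
tree's `metaVP kk` / `metaVQP kk` (`BDGIL24IsotypicNaturalProofs.lean`, stated with
`cc = affComplexity`) one may replace `cc` by Bürgisser's gate count `complexity` (variables as
input gates) without changing the class.

* `card_degIdx_eq_numMonomials` — a metapolynomial of format `(∗, n, k(n))` has exactly
  `N(n) = numMonomials kk n` variables (stars and bars);
* closure bookkeeping for "polynomially / quasipolynomially bounded in `N(n)`":
  `GKSS2017.IsPBoundedIn.mono/const/add/mul/self` and
  `IsQPBoundedIn.mono/of_isPBoundedIn/add/mul` (transported from the tree's `IsPBounded`,
  `IsQPBounded` closure lemmas along `n ↦ N n`);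
* `isPBoundedIn_complexity_iff`, `isQPBoundedIn_complexity_iff` — `L(Δ_n)` is (quasi)polynomially
  bounded in `N(n)` iff `cc(Δ_n)` is (`complexity_le_of_affComplexity`:
  `L ≤ cc + (2cc + 1)(2N + 1)`, and `affComplexity_le_complexity`);
* **`metaVP_eq_setOf_complexity`**, **`metaVQP_eq_setOf_complexity`** — "both definitions give the
  same class".

No definitions, no named facts. Honest framing: model bookkeeping; nothing here bears on `VP ≠ VNP`.

## References
* [BergEtAl2024] arXiv:2411.03444, §2.1 p.6 (PDF p.7); §2.5 p.9 (PDF p.10).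
-/

noncomputable section

open MvPolynomial

namespace Literature.Barriers.ValiantsHypothesis

open Literature.Computability.AlgebraicComplexity

/-! ### Bookkeeping: (quasi)polynomially bounded in `N(n)` -/

namespace GKSS2017.IsPBoundedIn

/-- Domination preserves "polynomial in `N(n)`". [cite: GrochowKumarSaksSaraf2017, Def. 2′, p.6] -/
protected theorem mono {N s t : ℕ → ℕ} (ht : IsPBoundedIn N t) (h : ∀ n, s n ≤ t n) :
    IsPBoundedIn N s := by
  obtain ⟨c, hc⟩ := ht
  exact ⟨c, fun n => (h n).trans (hc n)⟩

/-- Constants are polynomial in `N(n)`. [cite: GrochowKumarSaksSaraf2017, Def. 2′, p.6] -/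
protected theorem const (N : ℕ → ℕ) (c : ℕ) : IsPBoundedIn N fun _ => c :=
  ⟨c, fun _ => Nat.le_add_left c _⟩

/-- `N` itself is polynomial in `N(n)`. [cite: GrochowKumarSaksSaraf2017, Def. 2′, p.6] -/
protected theorem self (N : ℕ → ℕ) : IsPBoundedIn N N :=
  ⟨1, fun n => by rw [pow_one]; exact Nat.le_add_right _ _⟩

/-- "Polynomial in `N(n)`" is closed under sums (transport of `IsPBounded.add` along `N`).
[cite: GrochowKumarSaksSaraf2017, Def. 2′, p.6] -/
protected theorem add {N s t : ℕ → ℕ} (hs : IsPBoundedIn N s) (ht : IsPBoundedIn N t) :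
    IsPBoundedIn N fun n => s n + t n := by
  obtain ⟨a, ha⟩ := hs
  obtain ⟨b, hb⟩ := ht
  obtain ⟨c, hc⟩ := IsPBounded.add_holds (s := fun m => m ^ a + a) (t := fun m => m ^ b + b)
    ⟨a, fun _ => le_rfl⟩ ⟨b, fun _ => le_rfl⟩
  exact ⟨c, fun n => (Nat.add_le_add (ha n) (hb n)).trans (hc (N n))⟩

/-- "Polynomial in `N(n)`" is closed under products (transport of `IsPBounded.mul` along `N`).
[cite: GrochowKumarSaksSaraf2017, Def. 2′, p.6] -/
protected theorem mul {N s t : ℕ → ℕ} (hs : IsPBoundedIn N s) (ht : IsPBoundedIn N t) :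
    IsPBoundedIn N fun n => s n * t n := by
  obtain ⟨a, ha⟩ := hs
  obtain ⟨b, hb⟩ := ht
  obtain ⟨c, hc⟩ := IsPBounded.mul_holds (s := fun m => m ^ a + a) (t := fun m => m ^ b + b)
    ⟨a, fun _ => le_rfl⟩ ⟨b, fun _ => le_rfl⟩
  exact ⟨c, fun n => (Nat.mul_le_mul (ha n) (hb n)).trans (hc (N n))⟩

end GKSS2017.IsPBoundedIn

namespace BergEtAl2024

namespace IsQPBoundedIn

/-- Domination preserves "quasipolynomial in `N(n)`". [cite: BergEtAl2024, §2.5, p.9 (PDF p.10)] -/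
protected theorem mono {N s t : ℕ → ℕ} (ht : IsQPBoundedIn N t) (h : ∀ n, s n ≤ t n) :
    IsQPBoundedIn N s := by
  obtain ⟨c, hc⟩ := ht
  exact ⟨c, fun n => (h n).trans (hc n)⟩

/-- Polynomial in `N(n)` implies quasipolynomial in `N(n)` (transport of "VP ⊆ VQP",
`IsPBounded.isQPBounded`, along `N`). [cite: BergEtAl2024, §2.5, p.9 (PDF p.10)] -/
theorem of_isPBoundedIn {N t : ℕ → ℕ} (ht : GKSS2017.IsPBoundedIn N t) : IsQPBoundedIn N t := by
  obtain ⟨c, hc⟩ := ht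
  obtain ⟨a, ha⟩ := IsPBounded.isQPBounded (t := fun m => m ^ c + c) ⟨c, fun _ => le_rfl⟩
  exact ⟨a, fun n => (hc n).trans (ha (N n))⟩

/-- "Quasipolynomial in `N(n)`" is closed under sums (transport of `IsQPBounded.add` along `N`).
[cite: BergEtAl2024, §2.5, p.9 (PDF p.10)] -/
protected theorem add {N s t : ℕ → ℕ} (hs : IsQPBoundedIn N s) (ht : IsQPBoundedIn N t) :
    IsQPBoundedIn N fun n => s n + t n := by
  obtain ⟨a, ha⟩ := hs
  obtain ⟨b, hb⟩ := ht
  obtain ⟨c, hc⟩ := IsQPBounded.add (s := fun m => 2 ^ ((Nat.log 2 m + a) ^ a))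
    (t := fun m => 2 ^ ((Nat.log 2 m + b) ^ b)) ⟨a, fun _ => le_rfl⟩ ⟨b, fun _ => le_rfl⟩
  exact ⟨c, fun n => (Nat.add_le_add (ha n) (hb n)).trans (hc (N n))⟩

/-- "Quasipolynomial in `N(n)`" is closed under products (transport of `IsQPBounded.mul` along
`N`). [cite: BergEtAl2024, §2.5, p.9 (PDF p.10)] -/
protected theorem mul {N s t : ℕ → ℕ} (hs : IsQPBoundedIn N s) (ht : IsQPBoundedIn N t) :
    IsQPBoundedIn N fun n => s n * t n := by
  obtain ⟨a, ha⟩ := hs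
  obtain ⟨b, hb⟩ := ht
  obtain ⟨c, hc⟩ := IsQPBounded.mul (s := fun m => 2 ^ ((Nat.log 2 m + a) ^ a))
    (t := fun m => 2 ^ ((Nat.log 2 m + b) ^ b)) ⟨a, fun _ => le_rfl⟩ ⟨b, fun _ => le_rfl⟩
  exact ⟨c, fun n => (Nat.mul_le_mul (ha n) (hb n)).trans (hc (N n))⟩

end IsQPBoundedIn

/-! ### The number of variables of a metapolynomial of format `(∗, n, k(n))` -/

/-- A metapolynomial of format `(∗, n, k)` has `binom(k + n − 1, n)` variables (the coefficients of a
degree-`n` form in `k` variables; stars and bars), i.e. exactly `N(n) = numMonomials kk n` of §2.5.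
[cite: BergEtAl2024, §2.5, p.9 (PDF p.10)] locator: paper:arxiv-2411.03444 p0010.txt:L30–L32 -/
theorem card_degIdx_eq_numMonomials (kk : ℕ → ℕ) (n : ℕ) :
    Fintype.card (DegIdx (Fin (kk n)) n) = numMonomials kk n := by
  rw [Fintype.card_coe, degMonomials, Finset.card_finsuppAntidiag_nat_eq_choose, Finset.card_univ,
    Fintype.card_fin, numMonomials]

/-! ### `cc` versus `L` along a sequence of metapolynomials -/

/-- **`L(Δ_n)` is polynomially bounded in `N(n)` iff `cc(Δ_n)` is** (`cc ≤ L ≤ cc + (2cc+1)(2N+1)`).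
[cite: BergEtAl2024, §2.1, p.6 (PDF p.7)] locator: paper:arxiv-2411.03444 p0007.txt:L21–L23 -/
theorem isPBoundedIn_complexity_iff (kk : ℕ → ℕ)
    (Δ : (n : ℕ) → MvPolynomial (DegIdx (Fin (kk n)) n) ℂ) :
    GKSS2017.IsPBoundedIn (numMonomials kk) (fun n => complexity (Δ n)) ↔
      GKSS2017.IsPBoundedIn (numMonomials kk) (fun n => affComplexity (Δ n)) := by
  constructor
  · exact fun h => h.mono fun n => affComplexity_le_complexity (Δ n)
  · intro h
    have h1 : GKSS2017.IsPBoundedIn (numMonomials kk) fun n => 2 * affComplexity (Δ n) + 1 :=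
      ((GKSS2017.IsPBoundedIn.const _ 2).mul h).add (GKSS2017.IsPBoundedIn.const _ 1)
    have h2 : GKSS2017.IsPBoundedIn (numMonomials kk) fun n => 2 * numMonomials kk n + 1 :=
      ((GKSS2017.IsPBoundedIn.const _ 2).mul (GKSS2017.IsPBoundedIn.self _)).add
        (GKSS2017.IsPBoundedIn.const _ 1)
    refine (h.add (h1.mul h2)).mono fun n => ?_
    have := complexity_le_of_affComplexity (Δ n)
    rwa [card_degIdx_eq_numMonomials kk n] at this

/-- **`L(Δ_n)` is quasipolynomially bounded in `N(n)` iff `cc(Δ_n)` is.**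
[cite: BergEtAl2024, §2.1, p.6 (PDF p.7)] locator: paper:arxiv-2411.03444 p0007.txt:L21–L23 -/
theorem isQPBoundedIn_complexity_iff (kk : ℕ → ℕ)
    (Δ : (n : ℕ) → MvPolynomial (DegIdx (Fin (kk n)) n) ℂ) :
    IsQPBoundedIn (numMonomials kk) (fun n => complexity (Δ n)) ↔
      IsQPBoundedIn (numMonomials kk) (fun n => affComplexity (Δ n)) := by
  constructor
  · exact fun h => h.mono fun n => affComplexity_le_complexity (Δ n)
  · intro h
    have h1 : IsQPBoundedIn (numMonomials kk) fun n => 2 * affComplexity (Δ n) + 1 :=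
      ((IsQPBoundedIn.of_isPBoundedIn (GKSS2017.IsPBoundedIn.const _ 2)).mul h).add
        (IsQPBoundedIn.of_isPBoundedIn (GKSS2017.IsPBoundedIn.const _ 1))
    have h2 : IsQPBoundedIn (numMonomials kk) fun n => 2 * numMonomials kk n + 1 :=
      IsQPBoundedIn.of_isPBoundedIn
        (((GKSS2017.IsPBoundedIn.const _ 2).mul (GKSS2017.IsPBoundedIn.self _)).add
          (GKSS2017.IsPBoundedIn.const _ 1))
    refine (h.add (h1.mul h2)).mono fun n => ?_
    have := complexity_le_of_affComplexity (Δ n)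
    rwa [card_degIdx_eq_numMonomials kk n] at this

/-! ### "Both definitions give the same class" -/

/-- **`metaVP` via the gate count.** The class `metaVP kk` (defined with the circuit size `cc` with
affine-linear input gates) coincides with the class obtained by bounding Bürgisser's gate count
`L = complexity` (variables as input gates) instead: "both definitions give the same class VP".
[cite: BergEtAl2024, §2.1, p.6 (PDF p.7); §2.5, p.9 (PDF p.10)] locator: paper:arxiv-2411.03444 p0007.txt:L21–L23 -/
theorem metaVP_eq_setOf_complexity (kk : ℕ → ℕ) :
    metaVP kk = {Δ | IsPBounded kk ∧ ∃ δ : ℕ → ℕ, (∀ n, (Δ n).IsHomogeneous (δ n)) ∧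
      GKSS2017.IsPBoundedIn (numMonomials kk) δ ∧
      GKSS2017.IsPBoundedIn (numMonomials kk) fun n => complexity (Δ n)} := by
  ext Δ
  simp only [metaVP, Set.mem_setOf_eq, isPBoundedIn_complexity_iff]

/-- **`metaVQP` via the gate count**: likewise for the quasipolynomial class `metaVQP kk`.
[cite: BergEtAl2024, §2.1, p.6 (PDF p.7); §2.5, p.9 (PDF p.10)] locator: paper:arxiv-2411.03444 p0010.txt:L32–L33 -/
theorem metaVQP_eq_setOf_complexity (kk : ℕ → ℕ) :
    metaVQP kk = {Δ | IsPBounded kk ∧ ∃ δ : ℕ → ℕ, (∀ n, (Δ n).IsHomogeneous (δ n)) ∧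
      GKSS2017.IsPBoundedIn (numMonomials kk) δ ∧
      IsQPBoundedIn (numMonomials kk) fun n => complexity (Δ n)} := by
  ext Δ
  simp only [metaVQP, Set.mem_setOf_eq, isQPBoundedIn_complexity_iff]

end BergEtAl2024

end Literature.Barriers.ValiantsHypothesis
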